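import Mathlib
import Summits.Ventures.HodgeRepro.Tier4.Line1.RowPlaneGenuine
import Summits.Ventures.HodgeRepro.Tier4.Line4.CentreAwayFinite

/-!
# Tier4/Line4/CentreAwayFiniteRow — C-L4-NONSPLIT-FINITE on the ROW PLANES: the genuine row plane `ofLinesRow q a b ε` (and the
seesaw plane `(mixedRow q a b).withTransportedTorus g g' …`) has the torus-data property, so `centreAway` is finite on the
level-one subgroup and DISCRETE when no place above `p` splits in `E′` — `hns` in plan-4's form `¬ IsSquare (t² − 4n)` in `k_v`

Blind re-derivation cell `pub-hodge-repro`, Tier 4 «prove the step» (README §9–§10), seat t4-L1-p2 (prover, LINE L1, gen 5;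
L4 service cut C-L4-NONSPLIT-FINITE, plan-4 g6 S15721 / S15767 («YES to the `withTransportedTorus` form»), statement S15764).
Tree path `lean/Summits/Ventures/HodgeRepro/Tier4/Line4/CentreAwayFiniteRow.lean`.  Imports `Line4/CentreAwayFinite` (the
general theorems) and L1-p3's `Line1/RowPlaneGenuine` (`IsGenuineRow` of the row plane, `Ω² = −n`, the diagonal Gram).  No literature.

* `det_ofLinesRow_B_ne_zero`, **`hasTorusData_ofLinesRow`** (L2-p3's `exists_torus_data` on the genuine row plane: `Ω² = −n`,
  `−n` not a square, `Ω B = −B Ωᵀ`, `det B ≠ 0`, `P` self-adjoint of rank `2`), `hasTorusData_withTransportedTorus` (the transport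
  keeps `B`, `Ω`, `P`, hence the torus `T` and its data), `compactSpace_torusInf_withTransportedTorus`.
* `not_isSquare_neg_of_not_isSquare_disc` — `¬ IsSquare (t² − 4n)` in `k_v` with `t = 0` gives `¬ IsSquare (−n)`.
* **`finite_centreAway_inter_levelAwayOne_of_nonsplit`** / **`discreteTopology_centreAway_of_nonsplit`** — on `ofLinesRow q a b ε`
  (S15764's statements verbatim); **`…_withTransportedTorus_of_nonsplit`** — the same on the seesaw plane of record
  `(mixedRow q a b).withTransportedTorus g g' hgg' hg'g hgΩ` (plan-4 S15767), the binder L2-p2's `hDA` consumes.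

Nothing here says anything about the status of the Hodge conjecture for CM abelian varieties, which is NOT proved
(HC_CM is NOT proved by anyone in this repository).
-/

set_option autoImplicit false

noncomputable section

namespace Summit.Ventures.HodgeRepro.Tier4.Line4

open Summit.Ventures.HodgeRepro.Tier4 Summit.Ventures.HodgeRepro.Tier4.Common Summit.Ventures.HodgeRepro.Tier4.Line1
  NumberField IsDedekindDomain Matrix

open scoped NumberField Classical

section Row

variable {k : Type} [Field k] [NumberField k]

/-- `−n` is not a square in `k_v` when `t² − 4n` is not (`t = 0`). -/
theorem not_isSquare_neg_of_not_isSquare_disc {q : QuadData k} (ht : q.t = 0) (v : HeightOneSpectrum (𝓞 k))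
    (h : ¬ IsSquare (algebraMap k (v.adicCompletion k) (q.t ^ 2 - 4 * q.n))) :
    ¬ IsSquare (-(algebraMap k (v.adicCompletion k) q.n)) := by
  rintro ⟨r, hr⟩
  apply h
  refine ⟨2 * r, ?_⟩
  rw [ht, map_sub, map_pow, map_mul, map_zero, map_ofNat]
  linear_combination (4 : v.adicCompletion k) * hr

variable (q : QuadData k) (a b ε : k)

/-- The determinant of the row Gram matrix is non-zero (`t = 0`, `a b ε n ≠ 0`). -/
theorem det_ofLinesRow_B_ne_zero (ha : a ≠ 0) (hb : b ≠ 0) (hε : ε ≠ 0) (ht : q.t = 0) (hn0 : q.n ≠ 0) :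
    (PlaneData.ofLinesRow q a b ε).B.det ≠ 0 := by
  rw [ofLinesRow_B, blockDiag4, re4, Matrix.coe_reindexAlgEquiv, Matrix.det_reindex_self,
    Matrix.det_fromBlocks_zero₂₁, Matrix.det_smul, det_lineGramRow, det_lineGramRow, ht]
  simp [ha, hb, hε, hn0]

/-- **The torus data of the row plane**: every `b ∈ T` is `esc x₀ y₀ P₀ + esc x₁ y₁ P₁` with `x_i² + n y_i² = 1`. -/
theorem exists_torus_data_ofLinesRow (ha : a ≠ 0) (hb : b ≠ 0) (hε : ε ≠ 0) (ht : q.t = 0) (hn : ¬ IsSquare (-q.n))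
    {g : GA (PlaneData.ofLinesRow q a b ε)} (hg : g ∈ torusT (PlaneData.ofLinesRow q a b ε)) :
    ∃ x y : Fin 2 → Ad k, GA.mat (PlaneData.ofLinesRow q a b ε) g =
      esc (PlaneData.ofLinesRow q a b ε) (x 0) (y 0) * adMat k ((PlaneData.ofLinesRow q a b ε).P 0) +
      esc (PlaneData.ofLinesRow q a b ε) (x 1) (y 1) * adMat k ((PlaneData.ofLinesRow q a b ε).P 1) ∧
      ∀ i, nrm q.n (x i) (y i) = 1 := by
  have hn0 : q.n ≠ 0 := fun h0 => hn (by rw [h0, neg_zero]; exact ⟨0, by simp⟩)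
  have hgen := isGenuineRow_ofLinesRow q a b ε ha hb hε ht hn
  exact exists_torus_data (PlaneData.ofLinesRow q a b ε) (ofLinesRow_Ω_sq q a b ε ht) hn hgen.2.1
    (det_ofLinesRow_B_ne_zero q a b ε ha hb hε ht hn0) hgen.2.2.1 hgen.2.2.2.2.1 hg

/-- **The genuine row plane has the torus-data property** (`d = n`). -/
theorem hasTorusData_ofLinesRow (ha : a ≠ 0) (hb : b ≠ 0) (hε : ε ≠ 0) (ht : q.t = 0) (hn : ¬ IsSquare (-q.n)) :
    HasTorusData (PlaneData.ofLinesRow q a b ε) q.n :=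
  fun _ hg => exists_torus_data_ofLinesRow q a b ε ha hb hε ht hn hg

/-- **C-L4-NONSPLIT-FINITE on the row plane** (S15764's statement): `centreAway ∩ levelAwayOne` is finite under `hns`. -/
theorem finite_centreAway_inter_levelAwayOne_of_nonsplit (ha : a ≠ 0) (hb : b ≠ 0) (hε : ε ≠ 0) (ht : q.t = 0)
    (hn : ¬ IsSquare (-q.n)) (hreal : ∀ w : InfinitePlace k, w.IsReal) (hcm : ∀ w, IsCMAt q w) (p : ℕ) (hp : p ≠ 0)
    (hns : ∀ v ∈ placesAbove (k := k) p, ¬ IsSquare (algebraMap k (v.adicCompletion k) (q.t ^ 2 - 4 * q.n))) :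
    ((centreAway (PlaneData.ofLinesRow q a b ε) (placesAbove p) :
      Set (torusFinAway (PlaneData.ofLinesRow q a b ε) (placesAbove p))) ∩
      levelAwayOne (PlaneData.ofLinesRow q a b ε) (placesAbove p)).Finite :=
  haveI := compactSpace_torusInf_ofLinesRow q a b ε ha hb hε hreal hcm
  finite_centreAway_inter_levelAwayOne _ (hasTorusData_ofLinesRow q a b ε ha hb hε ht hn) hp
    fun v hv => not_isSquare_neg_of_not_isSquare_disc ht v (hns v hv)

/-- **`centreAway` is DISCRETE on the row plane** under `hns`. -/
theorem discreteTopology_centreAway_of_nonsplit (ha : a ≠ 0) (hb : b ≠ 0) (hε : ε ≠ 0) (ht : q.t = 0)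
    (hn : ¬ IsSquare (-q.n)) (hreal : ∀ w : InfinitePlace k, w.IsReal) (hcm : ∀ w, IsCMAt q w) (p : ℕ) (hp : p ≠ 0)
    (hns : ∀ v ∈ placesAbove (k := k) p, ¬ IsSquare (algebraMap k (v.adicCompletion k) (q.t ^ 2 - 4 * q.n))) :
    DiscreteTopology (centreAway (PlaneData.ofLinesRow q a b ε) (placesAbove p)) :=
  haveI := compactSpace_torusInf_ofLinesRow q a b ε ha hb hε hreal hcm
  discreteTopology_centreAway _ (hasTorusData_ofLinesRow q a b ε ha hb hε ht hn) hp
    fun v hv => not_isSquare_neg_of_not_isSquare_disc ht v (hns v hv)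

end Row

/-! ## The seesaw plane of record `(mixedRow q a b).withTransportedTorus g g' hgg' hg'g hgΩ` (plan-4 S15767): the transport keeps
`B`, `Ω`, `P`, hence the torus `T`, its data and `T_∞` -/

section Transported

variable {k : Type} [Field k] [NumberField k] (q : QuadData k) (a b : k) (g g' : Matrix (Fin 4) (Fin 4) k)
  (hgg' : g * g' = 1) (hg'g : g' * g = 1) (hgΩ : g * (PlaneData.mixedRow q a b).Ω = (PlaneData.mixedRow q a b).Ω * g)

/-- The transported seesaw plane has the torus-data property (its `T`, `B`, `Ω`, `P` are those of `mixedRow q a b`). -/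
theorem hasTorusData_withTransportedTorus (ha : a ≠ 0) (hb : b ≠ 0) (ht : q.t = 0) (hn : ¬ IsSquare (-q.n)) :
    HasTorusData ((PlaneData.mixedRow q a b).withTransportedTorus g g' hgg' hg'g hgΩ) q.n :=
  fun _ hg => exists_torus_data_ofLinesRow q a b (-1) ha hb (by norm_num) ht hn hg

/-- `T_∞` of the transported seesaw plane is compact (it is `T_∞` of `mixedRow q a b`). -/
theorem compactSpace_torusInf_withTransportedTorus (ha : a ≠ 0) (hb : b ≠ 0)
    (hreal : ∀ w : InfinitePlace k, w.IsReal) (hcm : ∀ w, IsCMAt q w) :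
    CompactSpace (torusInf ((PlaneData.mixedRow q a b).withTransportedTorus g g' hgg' hg'g hgΩ)) :=
  compactSpace_torusInf_ofLinesRow q a b (-1) ha hb (by norm_num) hreal hcm

/-- **C-L4-NONSPLIT-FINITE on the seesaw plane of record**: `centreAway ∩ levelAwayOne` is finite under `hns`. -/
theorem finite_centreAway_inter_levelAwayOne_withTransportedTorus_of_nonsplit (ha : a ≠ 0) (hb : b ≠ 0) (ht : q.t = 0)
    (hn : ¬ IsSquare (-q.n)) (hreal : ∀ w : InfinitePlace k, w.IsReal) (hcm : ∀ w, IsCMAt q w) (p : ℕ) (hp : p ≠ 0)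
    (hns : ∀ v ∈ placesAbove (k := k) p, ¬ IsSquare (algebraMap k (v.adicCompletion k) (q.t ^ 2 - 4 * q.n))) :
    ((centreAway ((PlaneData.mixedRow q a b).withTransportedTorus g g' hgg' hg'g hgΩ) (placesAbove p) :
      Set (torusFinAway ((PlaneData.mixedRow q a b).withTransportedTorus g g' hgg' hg'g hgΩ) (placesAbove p))) ∩
      levelAwayOne ((PlaneData.mixedRow q a b).withTransportedTorus g g' hgg' hg'g hgΩ) (placesAbove p)).Finite :=
  haveI := compactSpace_torusInf_withTransportedTorus q a b g g' hgg' hg'g hgΩ ha hb hreal hcm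
  finite_centreAway_inter_levelAwayOne _ (hasTorusData_withTransportedTorus q a b g g' hgg' hg'g hgΩ ha hb ht hn) hp
    fun v hv => not_isSquare_neg_of_not_isSquare_disc ht v (hns v hv)

/-- **`centreAway` of the seesaw plane of record is DISCRETE** under `hns` — the binder of L2-p2's `hDA`. -/
theorem discreteTopology_centreAway_withTransportedTorus_of_nonsplit (ha : a ≠ 0) (hb : b ≠ 0) (ht : q.t = 0)
    (hn : ¬ IsSquare (-q.n)) (hreal : ∀ w : InfinitePlace k, w.IsReal) (hcm : ∀ w, IsCMAt q w) (p : ℕ) (hp : p ≠ 0)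
    (hns : ∀ v ∈ placesAbove (k := k) p, ¬ IsSquare (algebraMap k (v.adicCompletion k) (q.t ^ 2 - 4 * q.n))) :
    DiscreteTopology (centreAway ((PlaneData.mixedRow q a b).withTransportedTorus g g' hgg' hg'g hgΩ) (placesAbove p)) :=
  haveI := compactSpace_torusInf_withTransportedTorus q a b g g' hgg' hg'g hgΩ ha hb hreal hcm
  discreteTopology_centreAway _ (hasTorusData_withTransportedTorus q a b g g' hgg' hg'g hgΩ ha hb ht hn) hp
    fun v hv => not_isSquare_neg_of_not_isSquare_disc ht v (hns v hv)

end Transported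

end Summit.Ventures.HodgeRepro.Tier4.Line4

end
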